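import Summits.CriticalPhenomena.SAWScalingLimit.Theses.SAWLatticeVirasoro
import Summits.CriticalPhenomena.SAWScalingLimit.Theorems.SAWDevelopingMapObservableToSLEChordalCarrierReduction
import Summits.CriticalPhenomena.SAWScalingLimit.Theorems.SAWDefectDecoherenceObservableToSLERModulusOfSimpleLimits
import HarnessLib

/-!
# Item `HexSimpleSubseqLimits` (stmt-CriticalPhenomena-7148): what is proved, and the exact
reduction of the rest to two lattice estimates

Target decl: `Summit.CriticalPhenomena.SAWScalingLimit.Theses.SAWLatticeVirasoro.HexSimpleSubseqLimits`
((S_H): every probability weak subsequential limit `ν` of the critical hexagonal SAW laws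
`hexSAWLaw D.carrier δ (a δ) (b δ)`, pushed to `CurveClass ℂ`, is carried by SIMPLE classes from
`D.pt 0` to `D.pt 1` with trace in `cl D` meeting `∂D` only at the two marked points).

PROVED here (all for an arbitrary Dobrushin domain and endpoint approximation
`IsEmbEndpointApprox hexGraph hexCenter D a b`):

* `mem_chordalCarrier_iff` — the five clauses of the item are, class by class, membership in the
  tree's Borel set `chordalCarrier D` (`HullRestrictionTests.lean`);
* `hexSimpleSubseqLimits_iff_ae_mem_chordalCarrier` — the item is literally the statement
  "every probability `IsSubseqLimitLaw` of the hexagonal SAW curves is carried by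
  `chordalCarrier D`";
* `ae_endpoints_range_of_tendsto` — the UNCONDITIONAL closed half, in the item's own binder
  shape: `ν`-a.e. `γ.source = D.pt 0 ∧ γ.target = D.pt 1 ∧ γ.range ⊆ closure D.carrier`
  (portmanteau for closed events, through `FloorRatio.stub_chordalCarrier_endpoints`);
* `hexSimpleSubseqLimits_iff_halves` — the item is equivalent to the conjunction of its two
  non-closed clauses: a.e. simplicity and a.e. avoidance of every boundary piece
  `frontierPiece D k`;
* `hexSimpleSubseqLimits_of_uniformModulus_of_collars` — the item FOLLOWS from two quantitative
  lattice inputs: (i) the uniform injectivity modulus of the critical hexagonal SAW (for all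
  `ε, η > 0` some `θ > 0` with `P_δ(curve ∉ modulusClass ε θ) ≤ η` for all small `δ`), and
  (ii) collar families for the boundary pieces (`FloorRatio.stub_chordalCarrier_reduction`);
* `uniformModulus_of_hexTight_of_hexSimpleSubseqLimits` — conversely, under tightness along the
  mesh the item GIVES BACK input (i) (`ObservableToSLER.Modulus.stub_hexUniformModulus_of_simpleLimits`),
  so modulo tightness and boundary collars the item is EQUIVALENT to the uniform injectivity modulus;
* `isOpen_nearFrontierVisit`, `measureReal_le_of_isOpen`, `ae_disjoint_frontierPiece_of_boundaryDecay`
  — the boundary clause from the cleaner NO-BOUNDARY-CRAWLING bound (for all `ρ, θ > 0` some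
  `ε > 0` with `P_δ(trace comes ε-close to ∂D at a point ρ-far from a, b) ≤ θ` for all small `δ`):
  the near-boundary-visit event is open, so the open-set half of the portmanteau theorem kills the
  exact touch event; and `hexSimpleSubseqLimits_of_uniformModulus_of_boundaryDecay` — the item from
  the two lattice estimates (i) + no boundary crawling.

Status of what is not proved: the abstract shape "weak limits of laws carried by simple classes are
carried by simple classes" is false (`SimpleSubseqLimits.Negative.simple_not_isClosed`,
`exists_weakLimit_not_ae_simple`), so input (i) — a no-macroscopic-near-retracing bound for the
critical hexagonal SAW, uniform in the mesh — is genuinely needed; neither it nor the boundary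
collar decay (ii) is in print at `x = x_c` (Lawler–Schramm–Werner 2004 §3.4; Duminil-Copin–Smirnov
2012 §4), and the `δℤ²` twin `SAWLoopFugacityFlow.SimpleSubseqLimits` (stmt-CriticalPhenomena-4982)
is open in the tree for the same reason.
-/

noncomputable section

open scoped Topology NNReal ENNReal BoundedContinuousFunction
open Filter Set MeasureTheory Metric
open Literature.Probability.LatticeModels (HexVertex hexGraph hexCenter)
open Literature.Probability.RandomPlanarGeometry
open Literature.Probability.RandomPlanarGeometry.SAW
open Summit.CriticalPhenomena.SAWScalingLimit.Theorems.ObservableToSLE.FloorRatio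
open Summit.CriticalPhenomena.SAWScalingLimit.Theses.SAWLatticeVirasoro (HexSimpleSubseqLimits)

namespace Summit.CriticalPhenomena.SAWScalingLimit.Theorems.HexSimpleSubseqLimits

/-! ### The five clauses are membership in the chordal carrier -/

/-- **The item's clauses are `chordalCarrier` membership.** For a curve class `c` and a Dobrushin
domain `D`: `c` is simple, runs from `D.pt 0` to `D.pt 1`, has trace in `cl D` and meets `∂D`
only in `{D.pt 0, D.pt 1}` iff `c ∈ chordalCarrier D` (whose trace clause reads
`c.range ⊆ D ∪ {D.pt 0, D.pt 1}`): `cl D = D ∪ ∂D` and the open set `D` misses `∂D`. [folklore] -/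
theorem mem_chordalCarrier_iff {D : DobrushinDomain} {c : CurveClass ℂ} :
    c ∈ chordalCarrier D ↔
      c ∈ CurveClass.simple ∧ c.source = D.pt 0 ∧ c.target = D.pt 1 ∧
        c.range ⊆ closure D.carrier ∧ c.range ∩ frontier D.carrier ⊆ {D.pt 0, D.pt 1} := by
  simp only [chordalCarrier, mem_inter_iff, mem_setOf_eq, and_assoc]
  refine and_congr_right fun _ => and_congr_right fun _ => and_congr_right fun _ => ?_
  constructor
  · intro h
    refine ⟨fun x hx => ?_, fun x hx => ?_⟩
    · rcases h hx with hxD | hx01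
      · exact subset_closure hxD
      · rcases hx01 with rfl | rfl <;> exact frontier_subset_closure (D.pt_mem_frontier _)
    · rcases h hx.1 with hxD | hx01
      · exact absurd hx.2 (by rw [D.isOpen.frontier_eq]; exact fun h' => h'.2 hxD)
      · exact hx01
  · rintro ⟨hcl, hfr⟩ x hx
    have hxcl := hcl hx
    rw [closure_eq_self_union_frontier] at hxcl
    rcases hxcl with hxD | hxfr
    · exact Or.inl hxD
    · exact Or.inr (hfr ⟨hx, hxfr⟩)

/-! ### The item, restated through `IsSubseqLimitLaw` and `chordalCarrier` -/

/-- The item's convergence hypotheses (a mesh sequence `s n → 0⁺` and convergence of the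
push-forward laws on bounded continuous test functions) say exactly that `ν` is a subsequential
limit law of the hexagonal SAW curves (`IsSubseqLimitLaw`). [folklore] -/
theorem isSubseqLimitLaw_of_tendsto {D : DobrushinDomain} {a b : ℝ → HexVertex} {s : ℕ → ℝ}
    {ν : Measure (CurveClass ℂ)} (hs : Tendsto s atTop (𝓝[>] (0 : ℝ)))
    (hlim : ∀ f : CurveClass ℂ →ᵇ ℝ, Tendsto
      (fun n => ∫ γ, f γ.curve ∂hexSAWLaw D.carrier (s n) (a (s n)) (b (s n))) atTop
      (𝓝 (∫ x, f x ∂ν))) :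
    IsSubseqLimitLaw (fun δ (γ : HexDomainSAW D.carrier δ (a δ) (b δ)) => γ.curve)
      (fun δ => hexSAWLaw D.carrier δ (a δ) (b δ)) ν :=
  ⟨s, hs, hlim⟩

/-- **`HexSimpleSubseqLimits` ⇔ every probability subsequential limit law of the critical
hexagonal SAW curves is carried by the chordal carrier.** Pure bookkeeping: the binders of the item
are the definiens of `IsSubseqLimitLaw`, its five clauses are `chordalCarrier` membership
(`mem_chordalCarrier_iff`). [folklore] -/
theorem hexSimpleSubseqLimits_iff_ae_mem_chordalCarrier :
    HexSimpleSubseqLimits ↔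
      ∀ (D : DobrushinDomain) (a b : ℝ → HexVertex), IsEmbEndpointApprox hexGraph hexCenter D a b →
        ∀ μ : Measure (CurveClass ℂ), IsProbabilityMeasure μ →
          IsSubseqLimitLaw (fun δ (γ : HexDomainSAW D.carrier δ (a δ) (b δ)) => γ.curve)
            (fun δ => hexSAWLaw D.carrier δ (a δ) (b δ)) μ →
          ∀ᵐ c ∂μ, c ∈ chordalCarrier D := by
  constructor
  · intro h D a b hab μ hμ hlim
    obtain ⟨s, hs, hf⟩ := hlim
    filter_upwards [h D a b hab s μ hs hμ hf] with c hc
    exact mem_chordalCarrier_iff.2 hc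
  · intro h D a b hab s ν hs hν hf
    filter_upwards [h D a b hab ν hν (isSubseqLimitLaw_of_tendsto hs hf)] with c hc
    exact mem_chordalCarrier_iff.1 hc

/-! ### The unconditional closed half -/

/-- **Closed half of the item (unconditional).** For every Dobrushin domain, endpoint
approximation, mesh sequence `s n → 0⁺` and probability measure `ν` which is the weak limit of the
pushed-forward hexagonal SAW laws along `s n`: `ν`-a.e. class starts at `D.pt 0`, ends at
`D.pt 1` and has trace in `cl D` — three of the five clauses of `HexSimpleSubseqLimits`, the ones
that are closed conditions on `CurveClass ℂ` (portmanteau; lattice polylines live in `cl D`, their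
endpoints `δ a_δ → a`, `δ b_δ → b`).
[cite: BillingsleyCPM1999, Thm. 2.1 (portmanteau, closed sets)] -/
theorem ae_endpoints_range_of_tendsto (D : DobrushinDomain) (a b : ℝ → HexVertex)
    (hab : IsEmbEndpointApprox hexGraph hexCenter D a b) (s : ℕ → ℝ) (ν : Measure (CurveClass ℂ))
    (hs : Tendsto s atTop (𝓝[>] (0 : ℝ))) (hν : IsProbabilityMeasure ν)
    (hlim : ∀ f : CurveClass ℂ →ᵇ ℝ, Tendsto
      (fun n => ∫ γ, f γ.curve ∂hexSAWLaw D.carrier (s n) (a (s n)) (b (s n))) atTop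
      (𝓝 (∫ x, f x ∂ν))) :
    ∀ᵐ γ ∂ν, γ.source = D.pt 0 ∧ γ.target = D.pt 1 ∧ γ.range ⊆ closure D.carrier :=
  stub_chordalCarrier_endpoints D a b hab ν hν (isSubseqLimitLaw_of_tendsto hs hlim)

/-! ### The item is the conjunction of its two non-closed clauses -/

/-- **`HexSimpleSubseqLimits` ⇔ (a.e. simplicity) ∧ (a.e. avoidance of every boundary piece).**
The endpoint and confinement clauses being automatic (`ae_endpoints_range_of_tendsto`), the item is
equivalent to: for every probability subsequential limit law `μ` of the hexagonal SAW curves,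
`μ`-a.e. class is simple, and for every `k`, `μ`-a.e. trace misses
`frontierPiece D k = ∂D ∖ (B(a, 1/(k+1)) ∪ B(b, 1/(k+1)))`. [folklore] -/
theorem hexSimpleSubseqLimits_iff_halves :
    HexSimpleSubseqLimits ↔
      (∀ (D : DobrushinDomain) (a b : ℝ → HexVertex), IsEmbEndpointApprox hexGraph hexCenter D a b →
        ∀ μ : Measure (CurveClass ℂ), IsProbabilityMeasure μ →
          IsSubseqLimitLaw (fun δ (γ : HexDomainSAW D.carrier δ (a δ) (b δ)) => γ.curve)
            (fun δ => hexSAWLaw D.carrier δ (a δ) (b δ)) μ →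
          ∀ᵐ c ∂μ, c ∈ CurveClass.simple) ∧
      (∀ (D : DobrushinDomain) (a b : ℝ → HexVertex), IsEmbEndpointApprox hexGraph hexCenter D a b →
        ∀ μ : Measure (CurveClass ℂ), IsProbabilityMeasure μ →
          IsSubseqLimitLaw (fun δ (γ : HexDomainSAW D.carrier δ (a δ) (b δ)) => γ.curve)
            (fun δ => hexSAWLaw D.carrier δ (a δ) (b δ)) μ →
          ∀ k : ℕ, ∀ᵐ c ∂μ, Disjoint c.range (frontierPiece D k)) := by
  rw [hexSimpleSubseqLimits_iff_ae_mem_chordalCarrier]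
  constructor
  · intro h
    refine ⟨fun D a b hab μ hμ hlim => ?_, fun D a b hab μ hμ hlim k => ?_⟩
    · filter_upwards [h D a b hab μ hμ hlim] with c hc
      exact hc.1.1.1
    · filter_upwards [h D a b hab μ hμ hlim] with c hc
      have hr : c ∈ {c : CurveClass ℂ | c.range ⊆ D.carrier ∪ {D.pt 0, D.pt 1}} := hc.2
      rw [setOf_range_subset_eq] at hr
      exact disjoint_left.2 fun x hx hxZ => (mem_iInter.1 hr.2 k) hx hxZ
  · rintro ⟨hS, hB⟩ D a b hab μ hμ hlim
    haveI := hμ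
    exact ae_mem_chordalCarrier hab hlim (hS D a b hab μ hμ hlim) (hB D a b hab μ hμ hlim)

/-! ### Reduction to two lattice estimates -/

/-- **`HexSimpleSubseqLimits` from the uniform injectivity modulus and collar families.**
If for every Dobrushin domain and endpoint approximation
(i) (UNIFORM INJECTIVITY MODULUS of the critical hexagonal SAW) for all `ε, η > 0` there is `θ > 0`
with `hexSAWLaw`-mass `≤ η` on the walks whose curve class is outside `CurveClass.modulusClass ε θ`,
for all small meshes; and
(ii) (COLLAR FAMILIES) every boundary piece `frontierPiece D k` is covered by two closed sets each
avoided by the closures of subsets `Ω'_j ⊆ ℂ` whose lattice containment probabilities tend, as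
`δ → 0⁺`, to numbers `p_j → 1`;
then `HexSimpleSubseqLimits` holds. Both inputs are open at `x = x_c`; (i) is moreover necessary
given tightness (`uniformModulus_of_hexTight_of_hexSimpleSubseqLimits`).
[cite: LawlerSchrammWerner2003Restriction, Lemma 3.2 (avoidance sandwich, transposed)] -/
theorem hexSimpleSubseqLimits_of_uniformModulus_of_collars
    (hS : ∀ (D : DobrushinDomain) (a b : ℝ → HexVertex),
      IsEmbEndpointApprox hexGraph hexCenter D a b →
      ∀ ε η : ℝ, 0 < ε → 0 < η → ∃ θ : ℝ, 0 < θ ∧ ∀ᶠ δ : ℝ in 𝓝[>] 0,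
        hexSAWLaw D.carrier δ (a δ) (b δ) {γ | γ.curve ∉ CurveClass.modulusClass ε θ} ≤
          ENNReal.ofReal η)
    (hcol : ∀ (D : DobrushinDomain) (a b : ℝ → HexVertex),
      IsEmbEndpointApprox hexGraph hexCenter D a b →
      ∀ k : ℕ, ∃ Z₁ Z₂ : Set ℂ, IsClosed Z₁ ∧ IsClosed Z₂ ∧
        frontierPiece D k ⊆ Z₁ ∪ Z₂ ∧ ∀ Z ∈ ({Z₁, Z₂} : Set (Set ℂ)),
          ∃ (Ω' : ℕ → Set ℂ) (p : ℕ → ℝ), Tendsto p atTop (𝓝 1) ∧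
            (∀ j, Disjoint (closure (Ω' j)) Z) ∧
            ∀ j, Tendsto (fun δ : ℝ => ((hexSAWLaw D.carrier δ (a δ) (b δ))
              {γ | (∀ v ∈ γ.walk.support, v ∈ embMeshVertices hexCenter (Ω' j) δ) ∧
                ∀ e ∈ γ.walk.darts,
                  (embMeshGraph hexGraph hexCenter (Ω' j) δ).Adj e.fst e.snd}).toReal)
              (𝓝[>] 0) (𝓝 (p j))) :
    HexSimpleSubseqLimits :=
  hexSimpleSubseqLimits_iff_ae_mem_chordalCarrier.2 fun D a b hab μ hμ hlim =>
    stub_chordalCarrier_reduction D a b hab (hS D a b hab) (hcol D a b hab) μ hμ hlim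

/-- **Necessity of the uniform injectivity modulus, given tightness.** If the pushed-forward
hexagonal SAW laws are tight along the mesh for every Dobrushin domain and endpoint approximation,
then `HexSimpleSubseqLimits` implies the uniform injectivity modulus (i) of
`hexSimpleSubseqLimits_of_uniformModulus_of_collars` (Prokhorov + closed-set portmanteau on
thickened modulus events, `ObservableToSLER.Modulus.stub_hexUniformModulus_of_simpleLimits`).
[cite: BillingsleyCPM1999, Thm. 5.1 (Prokhorov) and Thm. 2.1 (portmanteau)] -/
theorem uniformModulus_of_hexTight_of_hexSimpleSubseqLimits
    (hT : ∀ (D : DobrushinDomain) (a b : ℝ → HexVertex),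
      IsEmbEndpointApprox hexGraph hexCenter D a b →
      IsTightAlongMesh (fun δ (γ : HexDomainSAW D.carrier δ (a δ) (b δ)) => γ.curve)
        (fun δ => hexSAWLaw D.carrier δ (a δ) (b δ)))
    (h : HexSimpleSubseqLimits) :
    ∀ (D : DobrushinDomain) (a b : ℝ → HexVertex), IsEmbEndpointApprox hexGraph hexCenter D a b →
      ∀ ε > (0 : ℝ), ∀ η > (0 : ℝ), ∃ θ > (0 : ℝ), ∀ᶠ δ : ℝ in 𝓝[>] 0,
        hexSAWLaw D.carrier δ (a δ) (b δ) {γ | γ.curve ∉ CurveClass.modulusClass ε θ} ≤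
          ENNReal.ofReal η :=
  ObservableToSLER.Modulus.stub_hexUniformModulus_of_simpleLimits hT h

/-! ### The boundary clause from a no-boundary-crawling bound -/

section BoundaryDecay

variable {D : DobrushinDomain} {a b : ℝ → HexVertex} {μ : Measure (CurveClass ℂ)}

/-- **The near-boundary-visit event is open.** The event "the trace has a point `ε`-close to `∂D`
(`infDist < ε`) and `ρ`-far from both marked points" (strict inequalities, phrased through the
trace, hence reparametrisation invariant) is OPEN in `CurveClass ℂ`: every trace point of a class
is within the curve distance of the trace of a nearby class (`Curve.infDist_range_le`), and the
three strict inequalities have a common margin. [cite: AizenmanBurchard1999, §2.1 (curve-space topology)] -/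
theorem isOpen_nearFrontierVisit (D : DobrushinDomain) (ρ ε : ℝ) :
    IsOpen {c : CurveClass ℂ | ∃ x ∈ c.range, infDist x (frontier D.carrier) < ε ∧
      ρ < dist x (D.pt 0) ∧ ρ < dist x (D.pt 1)} := by
  rw [Metric.isOpen_iff]
  rintro c ⟨x, hx, hε, h0, h1⟩
  obtain ⟨γ, rfl⟩ := CurveClass.surjective_mk c
  rw [CurveClass.range_mk] at hx
  obtain ⟨t, rfl⟩ := hx
  set m : ℝ := min (ε - infDist (γ t) (frontier D.carrier))
    (min (dist (γ t) (D.pt 0) - ρ) (dist (γ t) (D.pt 1) - ρ)) with hm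
  have hmpos : 0 < m := lt_min (by linarith) (lt_min (by linarith) (by linarith))
  refine ⟨m, hmpos, fun c' hc' => ?_⟩
  obtain ⟨γ', rfl⟩ := CurveClass.surjective_mk c'
  rw [Metric.mem_ball, CurveClass.dist_mk_mk, dist_comm] at hc'
  have hlt : infDist (γ t) γ'.range < m := (Curve.infDist_range_le γ γ' t).trans_lt hc'
  obtain ⟨x', hx', hxx'⟩ := (Metric.infDist_lt_iff γ'.range_nonempty).1 hlt
  have hm1 : m ≤ ε - infDist (γ t) (frontier D.carrier) := min_le_left _ _
  have hm2 : m ≤ dist (γ t) (D.pt 0) - ρ := (min_le_right _ _).trans (min_le_left _ _)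
  have hm3 : m ≤ dist (γ t) (D.pt 1) - ρ := (min_le_right _ _).trans (min_le_right _ _)
  refine ⟨x', by rwa [CurveClass.range_mk], ?_, ?_, ?_⟩
  · have := infDist_le_infDist_add_dist (s := frontier D.carrier) (x := x') (y := γ t)
    rw [dist_comm] at this
    linarith
  · have := dist_triangle (γ t) x' (D.pt 0)
    linarith
  · have := dist_triangle (γ t) x' (D.pt 1)
    linarith

/-- **Open-set half of the portmanteau theorem, for the hexagonal SAW limit laws.** If `U` is open
and the `hexSAWLaw`-mass of `{curve ∈ U}` is eventually `≤ θ` as `δ → 0⁺`, then every probability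
subsequential limit law gives `U` mass `≤ θ` (closed-set transfer on `Uᶜ`).
[cite: BillingsleyCPM1999, Thm. 2.1 (portmanteau, open sets)] -/
theorem measureReal_le_of_isOpen [IsProbabilityMeasure μ]
    (hμ : IsSubseqLimitLaw (fun δ (γ : HexDomainSAW D.carrier δ (a δ) (b δ)) => γ.curve)
      (fun δ => hexSAWLaw D.carrier δ (a δ) (b δ)) μ)
    {U : Set (CurveClass ℂ)} (hU : IsOpen U) {θ : ℝ} (hθ : 0 ≤ θ)
    (h : ∀ᶠ δ : ℝ in 𝓝[>] 0,
      hexSAWLaw D.carrier δ (a δ) (b δ) {γ | γ.curve ∈ U} ≤ ENNReal.ofReal θ) :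
    μ.real U ≤ θ := by
  have hc : 1 - θ ≤ μ.real Uᶜ := by
    refine le_measureReal_of_isClosed hμ hU.isClosed_compl (h.mono fun δ hδ hP => ?_)
    haveI := hP
    have h1 : (hexSAWLaw D.carrier δ (a δ) (b δ)).real {γ | γ.curve ∈ U} ≤ θ :=
      ENNReal.toReal_le_of_le_ofReal hθ hδ
    have hcompl : {γ : HexDomainSAW D.carrier δ (a δ) (b δ) | γ.curve ∈ Uᶜ} =
        {γ | γ.curve ∈ U}ᶜ := rfl
    rw [hcompl, probReal_compl_eq_one_sub MeasurableSpace.measurableSet_top]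
    linarith
  have h2 := probReal_compl_eq_one_sub (μ := μ) hU.measurableSet
  linarith

/-- **Boundary avoidance from a no-boundary-crawling bound.** HYPOTHESIS (boundary decay of the
critical hexagonal SAW in `(D; a, b)`): for every separation `ρ > 0` and target `θ > 0` there is a
width `ε > 0` such that, for all small meshes, the `hexSAWLaw`-mass of the walks whose rescaled
trace comes `ε`-close to `∂D` at a point `ρ`-far from both marked points is `≤ θ`.
CONCLUSION: every probability subsequential limit law is carried by classes whose trace misses
every boundary piece `frontierPiece D k` — the boundary clause of `HexSimpleSubseqLimits`.
Proof: touching `frontierPiece D k` forces membership in the OPEN near-boundary-visit event at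
`ρ = 1/(k+2)` and every width `ε` (`isOpen_nearFrontierVisit`); its limit mass is `≤ θ` for every
`θ` (`measureReal_le_of_isOpen`). [cite: BillingsleyCPM1999, Thm. 2.1 (portmanteau, open sets)] -/
theorem ae_disjoint_frontierPiece_of_boundaryDecay [IsProbabilityMeasure μ]
    (hμ : IsSubseqLimitLaw (fun δ (γ : HexDomainSAW D.carrier δ (a δ) (b δ)) => γ.curve)
      (fun δ => hexSAWLaw D.carrier δ (a δ) (b δ)) μ)
    (hB : ∀ ρ θ : ℝ, 0 < ρ → 0 < θ → ∃ ε : ℝ, 0 < ε ∧ ∀ᶠ δ : ℝ in 𝓝[>] 0,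
      hexSAWLaw D.carrier δ (a δ) (b δ)
        {γ | ∃ x ∈ γ.curve.range, infDist x (frontier D.carrier) < ε ∧
          ρ < dist x (D.pt 0) ∧ ρ < dist x (D.pt 1)} ≤ ENNReal.ofReal θ)
    (k : ℕ) : ∀ᵐ c ∂μ, Disjoint c.range (frontierPiece D k) := by
  set ρ : ℝ := 1 / ((k : ℝ) + 2) with hρ
  have hρpos : 0 < ρ := by positivity
  have hρlt : ρ < 1 / ((k : ℝ) + 1) := one_div_lt_one_div_of_lt (by positivity) (by linarith)
  -- the touch set lies in every near-boundary-visit event at separation `ρ`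
  set T : Set (CurveClass ℂ) := {c | ¬ Disjoint c.range (frontierPiece D k)} with hT
  have hsub : ∀ ε : ℝ, 0 < ε → T ⊆ {c : CurveClass ℂ | ∃ x ∈ c.range,
      infDist x (frontier D.carrier) < ε ∧ ρ < dist x (D.pt 0) ∧ ρ < dist x (D.pt 1)} := by
    intro ε hε c hc
    obtain ⟨x, hxr, hxZ⟩ := not_disjoint_iff.1 hc
    have hxfr : x ∈ frontier D.carrier := hxZ.1
    have hxa : ¬ dist x (D.pt 0) < 1 / ((k : ℝ) + 1) := fun h' => hxZ.2 (Or.inl (mem_ball.2 h'))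
    have hxb : ¬ dist x (D.pt 1) < 1 / ((k : ℝ) + 1) := fun h' => hxZ.2 (Or.inr (mem_ball.2 h'))
    refine ⟨x, hxr, ?_, ?_, ?_⟩
    · rwa [infDist_zero_of_mem hxfr]
    · linarith [not_lt.1 hxa]
    · linarith [not_lt.1 hxb]
  -- hence its limit mass is `≤ θ` for every `θ > 0`
  have hTle : ∀ θ : ℝ, 0 < θ → μ.real T ≤ θ := by
    intro θ hθ
    obtain ⟨ε, hε, hev⟩ := hB ρ θ hρpos hθ
    exact (measureReal_mono (hsub ε hε)).trans
      (measureReal_le_of_isOpen hμ (isOpen_nearFrontierVisit D ρ ε) hθ.le hev)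
  have hT0 : μ.real T = 0 :=
    le_antisymm (le_of_forall_pos_le_add fun θ hθ => by linarith [hTle θ hθ]) measureReal_nonneg
  have hT0' : μ T = 0 := (measureReal_eq_zero_iff (measure_ne_top μ T)).1 hT0
  filter_upwards [measure_eq_zero_iff_ae_notMem.1 hT0'] with c hc
  exact not_not.1 hc

/-- **`HexSimpleSubseqLimits` from two lattice estimates: no macroscopic near-retracing and no
boundary crawling.** If for every Dobrushin domain and endpoint approximation the critical
hexagonal SAW has (i) a UNIFORM INJECTIVITY MODULUS (for all `ε, η > 0` some `θ > 0` with
`hexSAWLaw`-mass `≤ η`, for all small meshes, on the walks whose class lies outside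
`CurveClass.modulusClass ε θ`) and (ii) BOUNDARY DECAY (for all `ρ, θ > 0` some `ε > 0` with
`hexSAWLaw`-mass `≤ θ`, for all small meshes, on the walks whose rescaled trace comes `ε`-close to
`∂D` at a point `ρ`-far from both marked points), then `HexSimpleSubseqLimits` holds. These are the
two quantitative inputs the item is waiting for; both are open at `x = x_c`.
[cite: BillingsleyCPM1999, Thm. 2.1 (portmanteau)] -/
theorem hexSimpleSubseqLimits_of_uniformModulus_of_boundaryDecay
    (hS : ∀ (D : DobrushinDomain) (a b : ℝ → HexVertex),
      IsEmbEndpointApprox hexGraph hexCenter D a b →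
      ∀ ε η : ℝ, 0 < ε → 0 < η → ∃ θ : ℝ, 0 < θ ∧ ∀ᶠ δ : ℝ in 𝓝[>] 0,
        hexSAWLaw D.carrier δ (a δ) (b δ) {γ | γ.curve ∉ CurveClass.modulusClass ε θ} ≤
          ENNReal.ofReal η)
    (hB : ∀ (D : DobrushinDomain) (a b : ℝ → HexVertex),
      IsEmbEndpointApprox hexGraph hexCenter D a b →
      ∀ ρ θ : ℝ, 0 < ρ → 0 < θ → ∃ ε : ℝ, 0 < ε ∧ ∀ᶠ δ : ℝ in 𝓝[>] 0,
        hexSAWLaw D.carrier δ (a δ) (b δ)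
          {γ | ∃ x ∈ γ.curve.range, infDist x (frontier D.carrier) < ε ∧
            ρ < dist x (D.pt 0) ∧ ρ < dist x (D.pt 1)} ≤ ENNReal.ofReal θ) :
    HexSimpleSubseqLimits := by
  refine hexSimpleSubseqLimits_iff_halves.2 ⟨fun D a b hab μ hμ hlim => ?_,
    fun D a b hab μ hμ hlim k => ?_⟩
  · haveI := hμ
    exact ae_mem_simple_of_uniformModulus hab hlim (hS D a b hab)
  · haveI := hμ
    exact ae_disjoint_frontierPiece_of_boundaryDecay hlim (hB D a b hab) k

end BoundaryDecay

end Summit.CriticalPhenomena.SAWScalingLimit.Theorems.HexSimpleSubseqLimits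

end
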